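import Literature.Probability.Percolation.BondInterfaceFaceDomainULC
import Literature.Probability.LatticeModels.MeshDomainJordan
import HarnessLib

/-!
# East march to a face-boundary dart (stub of line `face-kernel-k1`)

Marching east from an inner face `F` of an admissible discrete Dobrushin datum `E`, the faces
`F, F + e₀, …, F + j e₀` are inner and `F + (j+1) e₀` is not, for some `j` (the inner faces lie in
a box); the north dart at `F + (j+1) e₀` is then a face-boundary dart. Moreover the winding number
of any closed piece of any boundary walk is the same at `F + j e₀` and at `F`: two consecutive
inner faces share a side that no boundary walk uses (`W_bloop_eq_of_forall_ne`).
-/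

noncomputable section

open scoped Topology
open Filter Set Metric
open Literature.Probability Literature.Probability.LatticeModels Literature.Probability.Percolation
open Literature.Probability.LatticeModels.DiscreteDobrushin Literature.Probability.LatticeModels.Mesh
open Literature.Probability.RandomPlanarGeometry

namespace Summit.CriticalPhenomena.CardyFormulaZ2.Cruxes.ParafermionToSLESixFamilies.FaceKernel

/-- **East march to a face-boundary dart.** For an admissible discrete Dobrushin datum `E` and an
inner face `F`, there is `j` such that the north dart at `F + (j + 1) • e₀` is a face-boundary dart
(its west face `F + j • e₀` is inner, its east face `F + (j + 1) • e₀` is not), and the winding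
number of every closed piece `bloop i m hm hcl` of every boundary walk `E.bwalk d₀` is the same at
the face `F + j • e₀` as at `F`. -/
theorem stub_exists_isOutEdge_east :
    ∀ (E : DiscreteDobrushin), E.IsZdAdmissible → ∀ (F : Site 2), E.IsInnerFace F →
      ∃ j : ℕ, E.IsOutEdge (F + (j + 1) • cornerUnit 0) 1 ∧
        ∀ (d₀ : Site 2 × Fin 4), E.IsOutEdge d₀.1 d₀.2 →
          ∀ (i m : ℕ) (hm : 0 < m) (hcl : (E.bwalk d₀ (i + m)).1 = (E.bwalk d₀ i).1),
            (bloop i m hm hcl).W (toZ2 (faceAt (F + (j + 1) • cornerUnit 0) 1)) =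
              (bloop i m hm hcl).W (toZ2 F) := by
  intro E hE F hF
  classical
  -- (a) some eastern translate of `F` is not inner: the inner faces lie in a box
  have hex : ∃ n : ℕ, ¬ E.IsInnerFace (F + n • cornerUnit 0) := by
    obtain ⟨X₁, X₂, Y₁, hbox⟩ := exists_box_innerFaces hE.isBounded hE.delta_pos
    refine ⟨(X₂ - F 0 + 1).toNat, fun h => ?_⟩
    have h2 := (hbox _ h).2.1
    rw [add_nsmul_cornerUnit_apply] at h2
    simp only [cornerUnit, Pi.single_eq_same, mul_one] at h2
    omega
  -- (b) the first non-inner eastern translate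
  have h0 : Nat.find hex ≠ 0 := by
    intro h
    have hspec := Nat.find_spec hex
    rw [h, zero_smul, add_zero] at hspec
    exact hspec hF
  obtain ⟨j, hj⟩ : ∃ j, Nat.find hex = j + 1 := Nat.exists_eq_succ_of_ne_zero h0
  have hinner : ∀ n ≤ j, E.IsInnerFace (F + n • cornerUnit 0) := by
    intro n hn
    have hmin := Nat.find_min hex (show n < Nat.find hex by omega)
    rwa [not_not] at hmin
  have hnot : ¬ E.IsInnerFace (F + (j + 1) • cornerUnit 0) := hj ▸ Nat.find_spec hex
  -- the faces around the north dart at `x + e₀`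
  have hf0 : ∀ x : Site 2, faceAt x 0 = x := fun x => by simp [faceAt, cornerOff]
  have hfs : ∀ x : Site 2, faceAt (x + cornerUnit 0) 1 = x := fun x => by
    have h := faceAt_add_unit_succ x 0
    rwa [zero_add, hf0] at h
  have hf1 : ∀ n : ℕ, faceAt (F + (n + 1) • cornerUnit 0) 1 = F + n • cornerUnit 0 := fun n => by
    rw [add_succ_nsmul_cornerUnit, hfs]
  refine ⟨j, ⟨?_, ?_⟩, ?_⟩
  · rw [hf1]
    exact hinner j le_rfl
  · rw [show (1 : Fin 4) + 3 = 0 from rfl, hf0]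
    exact hnot
  · intro d₀ h₀ i m hm hcl
    rw [hf1]
    -- (c) the winding number is constant along the chain of inner faces `F + n • e₀`, `n ≤ j`
    suffices key : ∀ n ≤ j,
        (bloop i m hm hcl).W (toZ2 (F + n • cornerUnit 0)) = (bloop i m hm hcl).W (toZ2 F) from
      key j le_rfl
    intro n hn
    induction n with
    | zero => rw [zero_smul, add_zero]
    | succ n ih =>
      rw [← ih (Nat.le_of_succ_le hn)]
      -- the north dart at `x := F + (n + 1) • e₀` separates the inner faces `F + n • e₀` (west)
      -- and `F + (n + 1) • e₀` (east); neither it nor its reverse is a dart of the walk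
      have key := W_bloop_eq_of_forall_ne (i := i) (m := m) (hm := hm) (hcl := hcl)
        (x := F + (n + 1) • cornerUnit 0) (k := 1) ?_ ?_
      · rw [show (1 : Fin 4) + 3 = 0 from rfl, hf0, hf1] at key
        exact key.symm
      · intro t _ heq
        have hout := isOutEdge_bwalk h₀ (i + t)
        rw [heq] at hout
        have h2 := hout.2
        rw [show (1 : Fin 4) + 3 = 0 from rfl, hf0] at h2
        exact h2 (hinner (n + 1) hn)
      · intro t _ heq
        have hout := isOutEdge_bwalk h₀ (i + t)
        rw [heq] at hout
        have h2 := hout.2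
        rw [show (1 : Fin 4) + 2 + 3 = 1 + 1 from rfl, faceAt_add_unit_succ, hf1] at h2
        exact h2 (hinner n (Nat.le_of_succ_le hn))

end Summit.CriticalPhenomena.CardyFormulaZ2.Cruxes.ParafermionToSLESixFamilies.FaceKernel

end
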